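import Mathlib.Analysis.SpecialFunctions.Gamma.Beta
import Mathlib.Analysis.SpecialFunctions.Trigonometric.Basic
import Mathlib.Tactic.LinearCombination
import HarnessLib

/-!
# Γ-product values behind the radical period constants of Fermat-surface Hodge classes, d ∈ {6, 8} (proved values)

Topic: `Literature/Analysis/SpecialFunctions`. For a Hodge character `a = (a₀,…,a₃)` of the Fermat
surface `X^2_d : x₀^d + ⋯ + x₃^d = 0`, Deligne's normalised period constant is
`Γ̃(a) = (2πi)^{-2} ∏ᵢ Γ(aᵢ/d)` (Deligne, *Hodge cycles on abelian varieties*, LNM 900 (1982), I §7,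
(7.5), Prop. 7.13, Thm. 7.15: `Γ̃(a)` is algebraic, lies in an abelian extension of `ℚ(ζ_d)`, and its
Galois conjugates are the `Γ̃` of the conjugate characters). Among the `(ℤ/d)^×`-orbits of Hodge
characters of `X^2_6` and `X^2_8` exactly one per surface has `Γ̃ ∉ ℚ(ζ_d)` — they carry radicals
`2^{1/6}` resp. `2^{1/4}`. This file PROVES the four real `Γ`-product identities (one per orbit
member) from Legendre's duplication formula and Euler's reflection formula, both in Mathlib
(`Real.Gamma_mul_Gamma_add_half`, `Real.Gamma_mul_Gamma_one_sub`; `Real.Gamma_one_half_eq`):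

  `Γ(1/8)Γ(1/2)Γ(5/8)Γ(3/4) = 2^{5/4}π²`,   `Γ(1/4)Γ(3/8)Γ(1/2)Γ(7/8) = 2^{3/4}π²`,
  `Γ(1/6)Γ(1/2)Γ(2/3)²       = 2^{5/3}π²/√3`, `Γ(1/3)²Γ(1/2)Γ(5/6)      = 2^{4/3}π²/√3`.

Since `(2πi)² = −4π²`, these are the table values `Γ̃(1,4,5,6) = −2^{−3/4}`, `Γ̃(2,3,4,7) = −2^{−5/4}`
(`d = 8`), `Γ̃(1,3,4,4) = −2^{−1/3}/√3`, `Γ̃(2,2,3,5) = −2^{−2/3}/√3` (`d = 6`); in particular they certify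
the 2-adic radical exponents `1/4, 1/4, 1/6, 1/3` used by the cell pub-hlocus's absolute-Hodge audit
(HOME/ABSHODGE.md, REFEREE.md R10–R11). The identities are classical `Γ`-calculus (DLMF 5.5.3, 5.5.5),
proved here, not cited; no named fact is introduced. The `d = 9` orbit (`(1,4,6,7)`, `3^{1/6}`) needs
Gauss triplication (`GaussMultiplicationFormula_holds` in this directory) and is a separate file.

HONEST FRAMING (cell pub-hlocus): certified instances and evidence bearing on the general Hodge
conjecture; no claim.

## Sources

* P. Deligne, *Hodge cycles on abelian varieties* (notes by J. Milne), LNM 900, Springer 1982, I §7,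
  (7.5), Prop. 7.13, Thm. 7.15.
* NIST DLMF §5.5: 5.5.3 (reflection), 5.5.5 (duplication). https://dlmf.nist.gov/5.5
* T. Shioda, *On the Picard number of a Fermat surface*, J. Fac. Sci. Univ. Tokyo 28 (1982) — the
  Hodge characters of `X^2_d`.
-/

noncomputable section

open Real

namespace Literature.Analysis.SpecialFunctions

/-- `√2·√2 = 2`. [folklore] -/
private lemma s2 : (√2 : ℝ) * √2 = 2 := Real.mul_self_sqrt (by norm_num)
/-- `√3·√3 = 3`. [folklore] -/
private lemma s3 : (√3 : ℝ) * √3 = 3 := Real.mul_self_sqrt (by norm_num)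

/-- Euler reflection at 1/4: Γ(1/4)Γ(3/4) = √2·π. [cite: DLMF, 5.5.3] -/
lemma Real_Gamma_quarter_mul_three_quarters : Gamma (1/4) * Gamma (3/4) = √2 * π := by
  have h := Gamma_mul_Gamma_one_sub (1/4 : ℝ)
  rw [show (1:ℝ) - 1/4 = 3/4 by norm_num, show Real.pi * (1/4 : ℝ) = Real.pi / 4 by ring,
      Real.sin_pi_div_four] at h
  rw [h, div_div_eq_mul_div, div_eq_iff (by positivity : (√2 : ℝ) ≠ 0)]
  linear_combination (-Real.pi) * s2

/-- Euler reflection at 1/3: Γ(1/3)Γ(2/3) = 2π/√3. [cite: DLMF, 5.5.3] -/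
lemma Real_Gamma_third_mul_two_thirds : Gamma (1/3) * Gamma (2/3) = 2 * π / √3 := by
  have h := Gamma_mul_Gamma_one_sub (1/3 : ℝ)
  rw [show (1:ℝ) - 1/3 = 2/3 by norm_num, show Real.pi * (1/3 : ℝ) = Real.pi / 3 by ring,
      Real.sin_pi_div_three] at h
  rw [h, div_div_eq_mul_div]
  ring

/-- ABSHODGE table, X^8_2, orbit rep (1,4,5,6): ∏Γ(a_i/8) = 2^{5/4}·π², i.e. Γ̃ = −2^{−3/4} (e_2 = 1/4).[cite: DLMF, 5.5.5] [cite: Deligne1982HodgeCycles, I Thm 7.15] -/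
theorem Real_Gamma_prod_d8_orbit_1456 :
    Gamma (1/8) * Gamma (1/2) * Gamma (5/8) * Gamma (3/4) = 2 ^ ((5:ℝ)/4) * π ^ 2 := by
  have dup18 := Gamma_mul_Gamma_add_half (1/8 : ℝ)
  rw [show (1:ℝ)/8 + 1/2 = 5/8 by norm_num, show (2:ℝ) * (1/8) = 1/4 by norm_num,
      show (1:ℝ) - 1/4 = 3/4 by norm_num] at dup18
  calc Gamma (1/8) * Gamma (1/2) * Gamma (5/8) * Gamma (3/4)
      = (Gamma (1/8) * Gamma (5/8)) * (Gamma (1/2) * Gamma (3/4)) := by ring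
    _ = (Gamma (1/4) * 2 ^ ((3:ℝ)/4) * √π) * (√π * Gamma (3/4)) := by
        rw [dup18, Real.Gamma_one_half_eq]
    _ = (Gamma (1/4) * Gamma (3/4)) * 2 ^ ((3:ℝ)/4) * (√π * √π) := by ring
    _ = (√2 * π) * 2 ^ ((3:ℝ)/4) * π := by
        rw [Real_Gamma_quarter_mul_three_quarters, Real.mul_self_sqrt Real.pi_nonneg]
    _ = (2 ^ (1/(2:ℝ)) * 2 ^ ((3:ℝ)/4)) * π ^ 2 := by rw [Real.sqrt_eq_rpow]; ring
    _ = 2 ^ ((5:ℝ)/4) * π ^ 2 := by rw [← Real.rpow_add two_pos]; norm_num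

/-- ABSHODGE table, X^8_2, orbit member (2,3,4,7): ∏Γ(a_i/8) = 2^{3/4}·π², i.e. Γ̃ = −2^{−5/4} (e_2 = 1/4).[cite: DLMF, 5.5.5] [cite: Deligne1982HodgeCycles, I Thm 7.15] -/
theorem Real_Gamma_prod_d8_orbit_2347 :
    Gamma (1/4) * Gamma (3/8) * Gamma (1/2) * Gamma (7/8) = 2 ^ ((3:ℝ)/4) * π ^ 2 := by
  have dup38 := Gamma_mul_Gamma_add_half (3/8 : ℝ)
  rw [show (3:ℝ)/8 + 1/2 = 7/8 by norm_num, show (2:ℝ) * (3/8) = 3/4 by norm_num,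
      show (1:ℝ) - 3/4 = 1/4 by norm_num] at dup38
  calc Gamma (1/4) * Gamma (3/8) * Gamma (1/2) * Gamma (7/8)
      = (Gamma (3/8) * Gamma (7/8)) * (Gamma (1/4) * Gamma (1/2)) := by ring
    _ = (Gamma (3/4) * 2 ^ ((1:ℝ)/4) * √π) * (Gamma (1/4) * √π) := by
        rw [dup38, Real.Gamma_one_half_eq]
    _ = (Gamma (1/4) * Gamma (3/4)) * 2 ^ ((1:ℝ)/4) * (√π * √π) := by ring
    _ = (√2 * π) * 2 ^ ((1:ℝ)/4) * π := by
        rw [Real_Gamma_quarter_mul_three_quarters, Real.mul_self_sqrt Real.pi_nonneg]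
    _ = (2 ^ (1/(2:ℝ)) * 2 ^ ((1:ℝ)/4)) * π ^ 2 := by rw [Real.sqrt_eq_rpow]; ring
    _ = 2 ^ ((3:ℝ)/4) * π ^ 2 := by rw [← Real.rpow_add two_pos]; norm_num

/-- ABSHODGE table, X^6_2, orbit rep (1,3,4,4): ∏Γ(a_i/6) = 2^{5/3}·π²/√3, i.e. Γ̃ = −2^{−1/3}/√3 (e_2 = 1/6).[cite: DLMF, 5.5.5] [cite: Deligne1982HodgeCycles, I Thm 7.15] -/
theorem Real_Gamma_prod_d6_orbit_1344 :
    Gamma (1/6) * Gamma (1/2) * Gamma (2/3) * Gamma (2/3) = 2 ^ ((5:ℝ)/3) * π ^ 2 / √3 := by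
  have dup16 := Gamma_mul_Gamma_add_half (1/6 : ℝ)
  rw [show (1:ℝ)/6 + 1/2 = 2/3 by norm_num, show (2:ℝ) * (1/6) = 1/3 by norm_num,
      show (1:ℝ) - 1/3 = 2/3 by norm_num] at dup16
  calc Gamma (1/6) * Gamma (1/2) * Gamma (2/3) * Gamma (2/3)
      = (Gamma (1/6) * Gamma (2/3)) * (Gamma (1/2) * Gamma (2/3)) := by ring
    _ = (Gamma (1/3) * 2 ^ ((2:ℝ)/3) * √π) * (√π * Gamma (2/3)) := by
        rw [dup16, Real.Gamma_one_half_eq]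
    _ = (Gamma (1/3) * Gamma (2/3)) * 2 ^ ((2:ℝ)/3) * (√π * √π) := by ring
    _ = (2 * π / √3) * 2 ^ ((2:ℝ)/3) * π := by
        rw [Real_Gamma_third_mul_two_thirds, Real.mul_self_sqrt Real.pi_nonneg]
    _ = 2 ^ (1 + (2:ℝ)/3) * π ^ 2 / √3 := by rw [Real.rpow_add two_pos, Real.rpow_one]; ring
    _ = 2 ^ ((5:ℝ)/3) * π ^ 2 / √3 := by norm_num

/-- ABSHODGE table, X^6_2, orbit member (2,2,3,5): ∏Γ(a_i/6) = 2^{4/3}·π²/√3, i.e. Γ̃ = −2^{−2/3}/√3 (e_2 = 1/3).[cite: DLMF, 5.5.5] [cite: Deligne1982HodgeCycles, I Thm 7.15] -/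
theorem Real_Gamma_prod_d6_orbit_2235 :
    Gamma (1/3) * Gamma (1/3) * Gamma (1/2) * Gamma (5/6) = 2 ^ ((4:ℝ)/3) * π ^ 2 / √3 := by
  have dup13 := Gamma_mul_Gamma_add_half (1/3 : ℝ)
  rw [show (1:ℝ)/3 + 1/2 = 5/6 by norm_num, show (2:ℝ) * (1/3) = 2/3 by norm_num,
      show (1:ℝ) - 2/3 = 1/3 by norm_num] at dup13
  calc Gamma (1/3) * Gamma (1/3) * Gamma (1/2) * Gamma (5/6)
      = (Gamma (1/3) * Gamma (5/6)) * (Gamma (1/3) * Gamma (1/2)) := by ring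
    _ = (Gamma (2/3) * 2 ^ ((1:ℝ)/3) * √π) * (Gamma (1/3) * √π) := by
        rw [dup13, Real.Gamma_one_half_eq]
    _ = (Gamma (1/3) * Gamma (2/3)) * 2 ^ ((1:ℝ)/3) * (√π * √π) := by ring
    _ = (2 * π / √3) * 2 ^ ((1:ℝ)/3) * π := by
        rw [Real_Gamma_third_mul_two_thirds, Real.mul_self_sqrt Real.pi_nonneg]
    _ = 2 ^ (1 + (1:ℝ)/3) * π ^ 2 / √3 := by rw [Real.rpow_add two_pos, Real.rpow_one]; ring
    _ = 2 ^ ((4:ℝ)/3) * π ^ 2 / √3 := by norm_num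

end Literature.Analysis.SpecialFunctions
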